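import Mathlib.Analysis.Convex.PathConnected
import Literature.Probability.RandomPlanarGeometry.HullSubdomainPullback
import Literature.Probability.RandomPlanarGeometry.PlanarDomainsTopology
import HarnessLib

/-!
# Access from the interior of the pulled-back hull to the lower half-plane

Step T6b of the transposition of [LSW] Thm. 6.1 to `Literature.Probability.RandomPlanarGeometry.IsSLELaw.hullRestriction_eightThirds`
(plan in `ConformalRestrictionProofs`; G. F. Lawler, O. Schramm, W. Werner, *Conformal
restriction: the chordal case*, J. Amer. Math. Soc. **16** (2003), arXiv:math/0209343).

For a chordal uniformizing map `φ : (ℍ; 0, ∞) → (D; a, b)` and a subdomain `D' ⊆ D` with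
`b ∈ cl D'`, let `U' = φ⁻¹(D') ⊆ ℍ` (`ConformalEquiv.pullbackDomain`, whose complement in `ℍ` is
the pulled-back hull `A`). We PROVE (`joinedIn_compl_closure_pullbackDomain`): **every point
`z ∈ ℍ` off `closure U'` can be joined to `−i` by a path in `ℂ ∖ closure U'`.** This is what
makes the erosions of the interior of `A` eventually ANCHORED at `z` (`HullExhaustion`), i.e.
what lets the exhaustion of `int A` by `*`-hulls reach every point.

Proof, in the closed unit disc through Carathéodory's theorem in disc form
(`JordanDomain.exists_continuousOn_extension`, hypothesis `hC`: the extension `Ψ` of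
`φ ∘ C⁻¹` is a continuous bijection `closedBall → cl D`, hence a HOMEOMORPHISM,
`JordanDomain.exists_inverse_extension`) and the Jordan curve theorem (tree fact
`JordanCurveTheorem`, hypothesis `hJ`): `J'' = Ψ⁻¹(∂D')` is a Jordan curve whose inside is
`Ψ⁻¹(D')` (an open connected set with frontier `J''`, bounded); the point `w' = C z` lies in the
open set `ball ∖ Ψ⁻¹(cl D')`, inside the OUTSIDE of `J''`; the component `W'` of `w'` in that
open set accumulates at a point `ζ` of the unit circle off `Ψ⁻¹(cl D')` — otherwise
`∂W' ⊆ J''` and `W'` would be the whole unbounded outside; `ζ` is reached from `W'` through a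
small convex neighbourhood in the closed disc, and `C⁻¹` carries the path back to `ℍ̄`, ending
at the real point `C⁻¹ ζ ∉ closure U'`, from which one descends vertically into `{Im < 0}`.
-/

noncomputable section

open Set Filter Topology Metric Complex
open UpperHalfPlane (upperHalfPlaneSet isOpen_upperHalfPlaneSet)
open scoped NNReal

namespace Literature.Probability.RandomPlanarGeometry

/-! ### The inverse of the Carathéodory extension -/

namespace JordanDomain

variable {D : JordanDomain} {Ψ : ℂ → ℂ}

/-- **The Carathéodory extension is a homeomorphism onto `cl D`**: a continuous bijection from
the compact closed disc onto the Hausdorff `cl D` has a continuous inverse `Θ` on `cl D`.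
[cite: PommerenkeBBCM1992, Thm. 2.6] -/
theorem exists_inverse_extension (hΨc : ContinuousOn Ψ (closedBall 0 1))
    (hbij : BijOn Ψ (closedBall (0 : ℂ) 1) (closure D.carrier)) :
    ∃ Θ : ℂ → ℂ, ContinuousOn Θ (closure D.carrier) ∧
      MapsTo Θ (closure D.carrier) (closedBall 0 1) ∧
      (∀ ζ ∈ closedBall (0 : ℂ) 1, Θ (Ψ ζ) = ζ) ∧ ∀ w ∈ closure D.carrier, Ψ (Θ w) = w := by
  classical
  haveI : CompactSpace (closedBall (0 : ℂ) 1) :=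
    isCompact_iff_compactSpace.1 (isCompact_closedBall 0 1)
  set f : closedBall (0 : ℂ) 1 → closure D.carrier := hbij.mapsTo.restrict Ψ _ _ with hf
  have hfb : Function.Bijective f := by
    constructor
    · intro x y h
      exact Subtype.ext (hbij.injOn x.2 y.2 (congrArg Subtype.val h))
    · intro w
      obtain ⟨ζ, hζ, hw⟩ := hbij.surjOn w.2
      exact ⟨⟨ζ, hζ⟩, Subtype.ext hw⟩
  set e : closedBall (0 : ℂ) 1 ≃ₜ closure D.carrier :=
    Continuous.homeoOfEquivCompactToT2 (f := Equiv.ofBijective f hfb)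
      (hΨc.mapsToRestrict hbij.mapsTo) with he
  have he_apply : ∀ x : closedBall (0 : ℂ) 1, (e x : ℂ) = Ψ x := fun x ↦ rfl
  set Θ : ℂ → ℂ := fun w ↦ if hw : w ∈ closure D.carrier then (e.symm ⟨w, hw⟩ : ℂ) else 0
    with hΘ
  have hΘ_apply : ∀ {w : ℂ} (hw : w ∈ closure D.carrier), Θ w = (e.symm ⟨w, hw⟩ : ℂ) :=
    fun hw ↦ dif_pos hw
  refine ⟨Θ, ?_, ?_, ?_, ?_⟩
  · rw [continuousOn_iff_continuous_restrict]
    have : (closure D.carrier).restrict Θ = fun w ↦ (e.symm w : ℂ) := by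
      funext w
      exact hΘ_apply w.2
    rw [this]
    exact continuous_subtype_val.comp e.symm.continuous
  · intro w hw
    rw [hΘ_apply hw]
    exact (e.symm ⟨w, hw⟩).2
  · intro ζ hζ
    have hΨζ : Ψ ζ ∈ closure D.carrier := hbij.mapsTo hζ
    rw [hΘ_apply hΨζ]
    have : (⟨Ψ ζ, hΨζ⟩ : closure D.carrier) = e ⟨ζ, hζ⟩ := Subtype.ext (he_apply ⟨ζ, hζ⟩).symm
    rw [this, Homeomorph.symm_apply_apply]
  · intro w hw
    rw [hΘ_apply hw, ← he_apply, Homeomorph.apply_symm_apply]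

end JordanDomain

/-! ### The access theorem -/

section Access

variable {D D' : DobrushinDomain} {φ : ConformalEquiv upperHalfPlaneSet D.carrier}

/-- Under a chordal uniformizing map, the boundary extension maps `closure (φ⁻¹ D')` into
`closure D'`. [folklore] -/
theorem boundaryExtension_mapsTo_closure_pullbackDomain (hC : JordanDomain.exists_continuousOn_extension) :
    MapsTo φ.boundaryExtension (closure (φ.pullbackDomain D')) (closure D'.carrier) := by
  have hcont : ContinuousOn φ.boundaryExtension (closure (φ.pullbackDomain D')) :=
    (JordanDomain.continuousOn_boundaryExtension_of_disc hC D.toJordanDomain φ).mono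
      (closure_mono ConformalEquiv.pullbackDomain_subset)
  intro z hz
  have h1 := hcont.image_closure ⟨z, hz, rfl⟩
  refine closure_mono ?_ h1
  rintro _ ⟨u, hu, rfl⟩
  rw [φ.boundaryExtension_eq hu.1]
  exact hu.2

/-- **Access to the lower half-plane off the closure of the pulled-back domain.** For a chordal
uniformizing map `φ` of `(D; a, b)`, a subdomain `D' ⊆ D` with `b ∈ cl D'`, and
`z ∈ ℍ ∖ closure (φ⁻¹ D')`, there is a path from `z` to `−i` avoiding `closure (φ⁻¹ D')` (from
the Jordan curve theorem `hJ` and Carathéodory's theorem `hC`; see the module docstring). [folklore] -/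
theorem joinedIn_compl_closure_pullbackDomain (hJ : Literature.Topology.PlaneTopology.JordanCurveTheorem)
    (hC : JordanDomain.exists_continuousOn_extension) (hφ : D.IsChordalUniformizing φ)
    (hsub : D'.carrier ⊆ D.carrier) (hb : D.pt 1 ∈ closure D'.carrier) {z : ℂ}
    (hz : z ∈ upperHalfPlaneSet) (hzc : z ∉ closure (φ.pullbackDomain D')) :
    JoinedIn (closure (φ.pullbackDomain D'))ᶜ z (-I) := by
  have hz0 : 0 < z.im := hz
  -- Carathéodory data
  obtain ⟨Ψ, hΨc, hΨeq, hbij, hbij'⟩ := hC D.toJordanDomain (cayley.symm.trans φ)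
  obtain ⟨Θ, hΘc, hΘmaps, hΘΨ, hΨΘ⟩ := JordanDomain.exists_inverse_extension hΨc hbij
  have hclD' : closure D'.carrier ⊆ closure D.carrier := closure_mono hsub
  have hΨ1 : Ψ 1 = D.pt 1 := JordanDomain.extension_one_eq φ hΨc hΨeq hφ.2
  -- `Ψ = φ ∘ C⁻¹` on the ball, `Ψ (C u) = φ.boundaryExtension u` on `ℍ̄`
  have hΨball : ∀ w ∈ ball (0 : ℂ) 1, Ψ w = φ (cayleyInvFun w) := fun w hw ↦ by
    rw [hΨeq hw, ConformalEquiv.trans_apply, cayley_symm_apply]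
  -- the sets in the disc
  set G : Set ℂ := closedBall 0 1 ∩ Ψ ⁻¹' closure D'.carrier with hG
  set J : Set ℂ := closedBall 0 1 ∩ Ψ ⁻¹' frontier D'.carrier with hJdef
  set U : Set ℂ := ball 0 1 ∩ Ψ ⁻¹' D'.carrier with hU
  have hGclosed : IsClosed G := hΨc.preimage_isClosed_of_isClosed isClosed_closedBall isClosed_closure
  have hUopen : IsOpen U := (hΨc.mono ball_subset_closedBall).isOpen_inter_preimage isOpen_ball D'.isOpen
  have hUball : U ⊆ ball 0 1 := inter_subset_left
  have hJG : J ⊆ G := fun w hw ↦ ⟨hw.1, frontier_subset_closure hw.2⟩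
  have hUG : U ⊆ G := fun w hw ↦ ⟨ball_subset_closedBall hw.1, subset_closure hw.2⟩
  have h1G : (1 : ℂ) ∈ G := ⟨by simp, by rw [mem_preimage, hΨ1]; exact hb⟩
  -- `U = Θ '' D'` and `closure U = G`
  have hUeq : U = Θ '' D'.carrier := by
    ext w
    constructor
    · rintro ⟨hw, hwD'⟩
      exact ⟨Ψ w, hwD', hΘΨ w (ball_subset_closedBall hw)⟩
    · rintro ⟨v, hv, rfl⟩
      have hvD : v ∈ closure D.carrier := subset_closure (hsub hv)
      have hΘv : Θ v ∈ closedBall (0 : ℂ) 1 := hΘmaps hvD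
      have hΨΘv : Ψ (Θ v) = v := hΨΘ v hvD
      refine ⟨?_, by rw [mem_preimage, hΨΘv]; exact hv⟩
      -- `Θ v` is not on the circle: circle points go to the frontier of `D`, `v ∈ D' ⊆ D` open
      rcases (mem_closedBall.1 hΘv).lt_or_eq with hlt | heq
      · exact mem_ball.2 hlt
      · exfalso
        have hfr : Ψ (Θ v) ∈ frontier D.carrier :=
          hbij'.mapsTo (mem_sphere.2 heq)
        rw [hΨΘv] at hfr
        rw [D.isOpen.frontier_eq] at hfr
        exact hfr.2 (hsub hv)
  have hUconn : IsConnected U := by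
    rw [hUeq]
    exact D'.isConnected.image Θ (hΘc.mono (subset_closure.trans hclD'))
  have hclU : closure U = G := by
    refine Subset.antisymm (hGclosed.closure_subset_iff.2 hUG) fun w hw ↦ ?_
    -- `w = Θ (Ψ w)` with `Ψ w ∈ closure D'`, and `Θ` is continuous within `closure D` there
    have hwD : Ψ w ∈ closure D.carrier := hbij.mapsTo hw.1
    have h1 : ContinuousWithinAt Θ D'.carrier (Ψ w) :=
      (hΘc (Ψ w) hwD).mono (subset_closure.trans hclD')
    have h2 := h1.mem_closure_image hw.2
    rw [hΘΨ w hw.1, ← hUeq] at h2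
    exact h2
  have hfrU : frontier U = J := by
    rw [frontier, hUopen.interior_eq, hclU]
    ext w
    simp only [hG, hJdef, Set.mem_sdiff, mem_inter_iff, mem_preimage, hU]
    constructor
    · rintro ⟨⟨hw, hwcl⟩, hwU⟩
      refine ⟨hw, hwcl, ?_⟩
      rw [D'.isOpen.interior_eq]
      intro hwD'
      -- then `w ∈ ball` (as in `hUeq`) and `w ∈ U`
      apply hwU
      refine ⟨?_, hwD'⟩
      rcases (mem_closedBall.1 hw).lt_or_eq with hlt | heq
      · exact mem_ball.2 hlt
      · exfalso
        have hfr : Ψ w ∈ frontier D.carrier := hbij'.mapsTo (mem_sphere.2 heq)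
        rw [D.isOpen.frontier_eq] at hfr
        exact hfr.2 (hsub hwD')
    · rintro ⟨hw, hwcl, hwint⟩
      refine ⟨⟨hw, hwcl⟩, fun ⟨_, hwD'⟩ ↦ hwint ?_⟩
      rwa [D'.isOpen.interior_eq]
  -- `J` is a Jordan curve: homeomorphic (by `Θ`) to `frontier D'`, itself a circle
  have hJhomeo : Nonempty (AddCircle (1 : ℝ) ≃ₜ J) := by
    obtain ⟨e₀⟩ := D'.frontier_homeomorphic_addCircle
    have hfrD : frontier D'.carrier ⊆ closure D.carrier := frontier_subset_closure.trans hclD'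
    haveI : CompactSpace (frontier D'.carrier) := isCompact_iff_compactSpace.1
      (Metric.isCompact_of_isClosed_isBounded isClosed_frontier
        (D'.isBounded.closure.subset frontier_subset_closure))
    -- `Θ` restricted: a continuous bijection `frontier D' → J`
    have hmaps : MapsTo Θ (frontier D'.carrier) J := fun v hv ↦
      ⟨hΘmaps (hfrD hv), by rw [mem_preimage, hΨΘ v (hfrD hv)]; exact hv⟩
    set g : frontier D'.carrier → J := hmaps.restrict Θ _ _ with hg
    have hgb : Function.Bijective g := by
      constructor
      · intro x y h
        have h' : Θ x = Θ y := congrArg Subtype.val h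
        have := congrArg Ψ h'
        rw [hΨΘ x (hfrD x.2), hΨΘ y (hfrD y.2)] at this
        exact Subtype.ext this
      · rintro ⟨w, hw, hwfr⟩
        exact ⟨⟨Ψ w, hwfr⟩, Subtype.ext (hΘΨ w hw)⟩
    have hgc : Continuous g := (hΘc.mono hfrD).mapsToRestrict hmaps
    exact ⟨e₀.trans (Continuous.homeoOfEquivCompactToT2 (f := Equiv.ofBijective g hgb) hgc)⟩
  -- the two complementary components of `J`; `U` is the bounded one
  obtain ⟨B, E, hBo, hEo, hBc, hEc, hBE, hunion, hfB, hfE, hBb, hEb⟩ := hJ.exists_isBounded hJhomeo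
  have hUJ : U ⊆ Jᶜ := by
    intro w hwU hwJ
    have : Ψ w ∈ frontier D'.carrier := hwJ.2
    rw [D'.isOpen.frontier_eq] at this
    exact this.2 hwU.2
  -- a connected set in `Jᶜ` meeting `U` lies in `U` (its frontier is `J`)
  have hkey : ∀ W : Set ℂ, IsPreconnected W → W ⊆ Jᶜ → (W ∩ U).Nonempty → W ⊆ U := by
    intro W hW hWJ hWU
    refine hW.subset_of_closure_inter_subset hUopen hWU ?_
    rintro w ⟨hwcl, hwW⟩
    by_contra hwU
    have : w ∈ frontier U := by
      rw [frontier, hUopen.interior_eq]; exact ⟨hwcl, hwU⟩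
    rw [hfrU] at this
    exact hWJ hwW this
  have hUB : U = B := by
    rcases hUconn.isPreconnected.subset_or_subset hBo hEo hBE (hunion.symm ▸ hUJ) with h | h
    · refine h.antisymm (hkey B hBc.isPreconnected (hunion ▸ subset_union_left) ?_)
      obtain ⟨u, hu⟩ := hUconn.nonempty
      exact ⟨u, h hu, hu⟩
    · exfalso
      have hEU : E ⊆ U := hkey E hEc.isPreconnected (hunion ▸ subset_union_right)
        (let ⟨u, hu⟩ := hUconn.nonempty; ⟨u, h hu, hu⟩)
      exact hEb ((isBounded_ball (x := (0 : ℂ)) (r := 1)).subset (hEU.trans hUball))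
  -- the point `w' = C z` and the open set `O = ball ∖ G ⊆ E`
  set w' : ℂ := cayleyFun z with hw'
  have hzI : z + I ≠ 0 := add_I_ne_zero hz0.le
  have hw'ball : w' ∈ ball (0 : ℂ) 1 := mem_ball_zero_iff.2 ((norm_cayleyFun_lt_one_iff hzI).2 hz0)
  have hΨw' : Ψ w' = φ z := by rw [hΨball w' hw'ball, hw', cayleyInvFun_cayleyFun hzI]
  -- `Ψ w ∈ closure D'` forces `C⁻¹ w ∈ closure (φ⁻¹ D')` for `w` in the ball
  have hball_cl : ∀ w ∈ ball (0 : ℂ) 1, Ψ w ∈ closure D'.carrier →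
      cayleyInvFun w ∈ closure (φ.pullbackDomain D') := by
    intro w hw hwcl
    have hu : cayleyInvFun w ∈ upperHalfPlaneSet := cayleyInvFun_im_pos (mem_ball_zero_iff.1 hw)
    rw [hΨball w hw] at hwcl
    -- continuity of `φ⁻¹` within `D'` at `φ u ∈ closure D' ∩ D`
    have h1 : ContinuousWithinAt φ.symm D'.carrier (φ (cayleyInvFun w)) :=
      (φ.symm.continuousOn _ (φ.mapsTo hu)).mono hsub
    have h2 := h1.mem_closure_image hwcl
    rw [φ.symm_apply_apply hu] at h2
    refine closure_mono ?_ h2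
    rintro _ ⟨v, hv, rfl⟩
    exact ConformalEquiv.symm_mapsTo_pullbackDomain hsub hv
  have hw'G : w' ∉ G := fun h ↦ hzc (by
    have := hball_cl w' hw'ball h.2
    rwa [hw', cayleyInvFun_cayleyFun hzI] at this)
  set O : Set ℂ := ball 0 1 \ G with hO
  have hOopen : IsOpen O := isOpen_ball.sdiff hGclosed
  have hw'O : w' ∈ O := ⟨hw'ball, hw'G⟩
  have hOE : O ⊆ E := by
    intro w hw
    have hwJ : w ∈ Jᶜ := fun h ↦ hw.2 (hJG h)
    have : w ∈ B ∪ E := by rw [hunion]; exact hwJ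
    rcases this with h | h
    · exact absurd (hUG (hUB.symm ▸ h)) hw.2
    · exact h
  -- the component `W'` of `w'` in `O` accumulates at a circle point off `G`
  set W' := connectedComponentIn O w' with hW'
  have hW'open : IsOpen W' := hOopen.connectedComponentIn
  have hW'conn : IsConnected W' := isConnected_connectedComponentIn_iff.2 hw'O
  have hW'O : W' ⊆ O := connectedComponentIn_subset _ _
  obtain ⟨ζ, hζcl, hζsph, hζG⟩ : ∃ ζ ∈ closure W', ζ ∈ sphere (0 : ℂ) 1 ∧ ζ ∉ G := by
    by_contra hcon
    push Not at hcon
    -- then `frontier W' ⊆ J`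
    have hfrW : frontier W' ⊆ J := by
      intro w hw
      rw [frontier, hW'open.interior_eq] at hw
      obtain ⟨hwcl, hwW⟩ := hw
      have hwcb : w ∈ closedBall (0 : ℂ) 1 :=
        closure_ball (0 : ℂ) one_ne_zero ▸ closure_mono (hW'O.trans sdiff_subset) hwcl
      -- `w ∈ G`
      have hwG : w ∈ G := by
        rcases (mem_closedBall.1 hwcb).lt_or_eq with hlt | heq
        · by_contra hwG
          -- `w ∈ O`, so the component of `w` in `O` is an open neighbourhood meeting `W'`
          have hwO : w ∈ O := ⟨mem_ball.2 hlt, hwG⟩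
          apply hwW
          rw [mem_closure_iff_nhds] at hwcl
          obtain ⟨v, hvC, hvW⟩ := hwcl _ (hOopen.connectedComponentIn.mem_nhds
            (mem_connectedComponentIn hwO))
          rw [hW', connectedComponentIn_eq hvW, ← connectedComponentIn_eq hvC]
          exact mem_connectedComponentIn hwO
        · exact hcon w hwcl (mem_sphere.2 heq)
      -- and `w ∉ U` (`U = B` is open and misses `W' ⊆ E`)
      refine ⟨hwcb, ?_⟩
      have hwU : w ∉ U := by
        intro hwU
        rw [mem_closure_iff_nhds] at hwcl
        obtain ⟨v, hvU, hvW⟩ := hwcl _ (hUopen.mem_nhds hwU)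
        have hvB : v ∈ B := by rw [← hUB]; exact hvU
        exact Set.disjoint_left.1 hBE hvB (hOE (hW'O hvW))
      have h1 : Ψ w ∈ closure D'.carrier := hwG.2
      rw [closure_eq_self_union_frontier] at h1
      rcases h1 with h | h
      · exfalso
        apply hwU
        refine ⟨?_, h⟩
        rcases (mem_closedBall.1 hwcb).lt_or_eq with hlt | heq
        · exact mem_ball.2 hlt
        · exfalso
          have hfr : Ψ w ∈ frontier D.carrier := hbij'.mapsTo (mem_sphere.2 heq)
          rw [D.isOpen.frontier_eq] at hfr
          exact hfr.2 (hsub h)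
      · exact h
    -- so `W'` is clopen in the connected `E`, hence `E ⊆ W' ⊆ ball`: contradiction
    have hEW : E ⊆ W' := by
      refine hEc.isPreconnected.subset_of_closure_inter_subset hW'open
        ⟨w', hOE hw'O, mem_connectedComponentIn hw'O⟩ ?_
      rintro w ⟨hwcl, hwE⟩
      by_contra hwW
      have hwfr : w ∈ frontier W' := by
        rw [frontier, hW'open.interior_eq]; exact ⟨hwcl, hwW⟩
      have hwJ := hfrW hwfr
      have : w ∈ B ∪ E := Or.inr hwE
      rw [hunion] at this
      exact this hwJ
    exact hEb ((isBounded_ball (x := (0 : ℂ)) (r := 1)).subset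
      (hEW.trans (hW'O.trans sdiff_subset)))
  -- reach `ζ` from `w'` inside `closedBall ∖ G`
  obtain ⟨r, hr, hrG⟩ : ∃ r > 0, ball ζ r ⊆ Gᶜ :=
    Metric.isOpen_iff.1 hGclosed.isOpen_compl ζ hζG
  have hζcb : ζ ∈ closedBall (0 : ℂ) 1 := sphere_subset_closedBall hζsph
  obtain ⟨w'', hw''W, hw''r⟩ : (W' ∩ ball ζ r).Nonempty := by
    rw [mem_closure_iff_nhds] at hζcl
    obtain ⟨v, hv1, hv2⟩ := hζcl _ (ball_mem_nhds ζ hr)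
    exact ⟨v, hv2, hv1⟩
  set T : Set ℂ := W' ∪ (closedBall 0 1 ∩ ball ζ r) with hT
  have hw''cb : w'' ∈ closedBall (0 : ℂ) 1 := ball_subset_closedBall (hW'O hw''W).1
  have hTpc : IsPathConnected T :=
    (hW'open.isConnected_iff_isPathConnected.1 hW'conn).union
      (((convex_closedBall (0 : ℂ) 1).inter (convex_ball ζ r)).isPathConnected
        ⟨ζ, hζcb, mem_ball_self hr⟩)
      ⟨w'', hw''W, hw''cb, hw''r⟩
  have hTsub : T ⊆ closedBall 0 1 \ G := by
    rintro w (hw | ⟨hwcb, hwr⟩)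
    · exact ⟨ball_subset_closedBall (hW'O hw).1, (hW'O hw).2⟩
    · exact ⟨hwcb, hrG hwr⟩
  have hjoin : JoinedIn (closedBall 0 1 \ G) w' ζ :=
    (hTpc.joinedIn w' (Or.inl (mem_connectedComponentIn hw'O)) ζ
      (Or.inr ⟨hζcb, mem_ball_self hr⟩)).mono hTsub
  -- carry the path back to `ℍ̄` by `C⁻¹`
  have hne1 : ∀ w ∈ closedBall (0 : ℂ) 1 \ G, w ≠ 1 := fun w hw h ↦ hw.2 (h ▸ h1G)
  have hCinv : ContinuousOn cayleyInvFun (closedBall 0 1 \ G) :=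
    differentiableOn_cayleyInvFun.continuousOn.mono fun w hw ↦ hne1 w hw
  have himage : MapsTo cayleyInvFun (closedBall 0 1 \ G) (closure (φ.pullbackDomain D'))ᶜ := by
    intro w hw hucl
    -- `Ψ w = φ.boundaryExtension (C⁻¹ w) ∈ closure D'`, so `w ∈ G`
    have hu_im : 0 ≤ (cayleyInvFun w).im := by
      rw [cayleyInvFun_im]
      refine div_nonneg ?_ (normSq_nonneg _)
      have : normSq w ≤ 1 := by
        rw [normSq_eq_norm_sq]
        have h1 : ‖w‖ ≤ 1 := mem_closedBall_zero_iff.1 hw.1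
        nlinarith [norm_nonneg w]
      linarith
    have hΨw : Ψ w = φ.boundaryExtension (cayleyInvFun w) := by
      rw [JordanDomain.boundaryExtension_eq_of_extension φ hΨc hΨeq hu_im,
        cayleyFun_cayleyInvFun (hne1 w hw)]
    have hcl : φ.boundaryExtension (cayleyInvFun w) ∈ closure D'.carrier :=
      boundaryExtension_mapsTo_closure_pullbackDomain hC hucl
    exact hw.2 ⟨hw.1, by rw [mem_preimage, hΨw]; exact hcl⟩
  have hjoin' : JoinedIn (closure (φ.pullbackDomain D'))ᶜ z (cayleyInvFun ζ) := by
    obtain ⟨p, hp⟩ := hjoin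
    have hpc : Continuous fun t ↦ cayleyInvFun (p t) :=
      hCinv.comp_continuous p.continuous hp
    refine ⟨⟨⟨fun t ↦ cayleyInvFun (p t), hpc⟩, ?_, ?_⟩, fun t ↦ himage (hp t)⟩
    · simp [hw', cayleyInvFun_cayleyFun hzI]
    · simp
  -- descend from the real point `x = C⁻¹ ζ` into the lower half-plane and go to `-i`
  set x : ℂ := cayleyInvFun ζ with hx
  have hxim : x.im = 0 := cayleyInvFun_im_eq_zero (mem_sphere_zero_iff_norm.1 hζsph)
  have hxcl : x ∉ closure (φ.pullbackDomain D') :=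
    himage ⟨hζcb, hζG⟩
  have hlow : {v : ℂ | v.im < 0} ⊆ (closure (φ.pullbackDomain D'))ᶜ := by
    intro v hv hvcl
    have : v ∈ closure upperHalfPlaneSet :=
      closure_mono ConformalEquiv.pullbackDomain_subset hvcl
    rw [mem_closure_upperHalfPlaneSet_iff] at this
    exact absurd hv (not_lt.2 this)
  set T₂ : Set ℂ := segment ℝ x (x - I) ∪ {v : ℂ | v.im < 0} with hT₂
  have hT₂sub : T₂ ⊆ (closure (φ.pullbackDomain D'))ᶜ := by
    rintro v (hv | hv)
    · -- on the segment, either `v = x` or `Im v < 0`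
      obtain ⟨a, c, ha, hc, hac, rfl⟩ := hv
      rcases hc.lt_or_eq with hcpos | hc0
      · apply hlow
        show (a • x + c • (x - I)).im < 0
        simp only [Complex.add_im, Complex.smul_im, smul_eq_mul, Complex.sub_im, hxim,
          Complex.I_im]
        nlinarith
      · subst hc0
        rw [add_zero] at hac
        subst hac
        simpa using hxcl
    · exact hlow hv
  have hT₂pc : IsPathConnected T₂ := by
    refine (convex_segment x (x - I)).isPathConnected ⟨x, left_mem_segment ℝ x _⟩ |>.union
      ((convex_halfSpace_im_lt (0 : ℝ)).isPathConnected ⟨-I, by simp⟩) ?_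
    refine ⟨x - I, right_mem_segment ℝ x _, ?_⟩
    show (x - I).im < 0
    simp [hxim]
  have hjoin₂ : JoinedIn (closure (φ.pullbackDomain D'))ᶜ x (-I) :=
    (hT₂pc.joinedIn x (Or.inl (left_mem_segment ℝ x _)) (-I) (Or.inr (by simp))).mono hT₂sub
  exact hjoin'.trans hjoin₂

end Access

end Literature.Probability.RandomPlanarGeometry

end
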